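import Summits.AtomisticToContinuum.Crystallization.Theorems.ChartedPlanarOrderSepCounting

/-!
# Slot 7b by the method of planes, module P3a: explicit domination bounds (decomp-a2c lens-3 g26; critic row 519 (1) R1)

Blocker `N = ChartedPlanarOrder.ChartedZeroExcessLayered`, leaf 7b `…OverbindingBudgetStackedRigidityW.GapStressVanishesW (17/16)` (hypothesis
`hV` of the cut of record XXXI_ref).  The 7b line truncates every pair interaction at a Euclidean range `R`; all its error terms are controlled by
EXPLICIT, configuration-free bounds for sums of `‖x − y‖⁻⁶` over finite subsets of a `δ`-separated set.  This module supplies them: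

* §1 one-dimensional sums: `∑_{n ∈ t} n⁻² ≤ 2/M` over naturals `≥ M ≥ 1` (telescoping), hence `∑_{k ∈ s} b(k − k₀) ≤ 4/(M+1)` over integers
  with `|k − k₀| ≥ M` (`b k = (1+|k|)⁻²` of `…NashForceBalance`);
* §2 product sums on `ℤ³`: `∑_{k ∈ s} v_{k₀}(k) ≤ 192/(M+1)` when every `k ∈ s` has SOME coordinate at distance `≥ M` from `k₀`;
  the planar version on `ℤ²`: `∑ b(k₁−c₁) b(k₂−c₂) ≤ 32/(M+1)`;
* §3 span counting: at most `s` layer pairs `k < m ≤ l` straddling gap `m` have span `l − k = s`, so over any finite set of straddling pairs of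
  span `≥ S ≥ 1`, `∑ (l − k)⁻³ ≤ ∑_{s ≥ S} s⁻² ≤ 2/S`;
(far grid images, point sums over separated sets, kernel bounds are in `…ChartedPlanarOrderPlanesPointSums`.)

Mathlib only (+ the lens-3 modules imported); `[folklore]`; no instances, no notation, sorry-free.
-/

noncomputable section

open MeasureTheory Set Metric Filter Topology
open scoped RealInnerProductSpace
open Summit.AtomisticToContinuum.Crystallization.Theorems.ChartedPlanarOrderRigidityDoor
open Summit.AtomisticToContinuum.Crystallization.Theorems.ChartedPlanarOrderDensityDichotomy
open Summit.AtomisticToContinuum.Crystallization.Theorems.ChartedPlanarOrderMesoCut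
open Summit.AtomisticToContinuum.Crystallization.Theorems.ChartedPlanarOrderProfileSlavingLJ (pairForce layerForce IsStacked)
open Summit.AtomisticToContinuum.Crystallization.Theorems.ChartedPlanarOrderDoorLayered (Layered)
open Summit.AtomisticToContinuum.Crystallization.Theorems.ChartedPlanarOrderNashForceBalance
open Summit.AtomisticToContinuum.Crystallization.Theorems.ChartedPlanarOrderSepCounting (gridE gridE_fst norm_sq_eq_sum_inner)

namespace Summit.AtomisticToContinuum.Crystallization.Theorems.ChartedPlanarOrderPlanesDomination

/-! ## 1. One-dimensional sums -/

section OneDim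

/-- telescoping: `∑_{n ∈ [M, N)} (1/n − 1/(n+1)) = 1/M − 1/N`. -/
theorem sum_Ico_inv_sub_inv (M : ℕ) : ∀ N : ℕ, M ≤ N →
    ∑ n ∈ Finset.Ico M N, (1 / (n : ℝ) - 1 / ((n : ℝ) + 1)) = 1 / (M : ℝ) - 1 / (N : ℝ) := by
  intro N hMN
  induction N, hMN using Nat.le_induction with
  | base => simp
  | succ N hMN ih =>
    rw [Finset.sum_Ico_succ_top hMN, ih]
    push_cast
    ring

/-- ★ `∑_{n ∈ t} n⁻² ≤ 2/M` for a finite set `t` of naturals `≥ M ≥ 1`. -/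
theorem sum_inv_sq_le (t : Finset ℕ) {M : ℕ} (hM : 1 ≤ M) (ht : ∀ n ∈ t, M ≤ n) :
    ∑ n ∈ t, ((n : ℝ) ^ 2)⁻¹ ≤ 2 / M := by
  rcases t.eq_empty_or_nonempty with rfl | hne
  · simp only [Finset.sum_empty]; positivity
  set N := t.max' hne with hN
  have hMN : M ≤ N + 1 := le_trans (ht _ (t.max'_mem hne)) (Nat.le_succ _)
  have hsub : t ⊆ Finset.Ico M (N + 1) := fun n hn =>
    Finset.mem_Ico.mpr ⟨ht n hn, Nat.lt_succ_of_le (t.le_max' n hn)⟩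
  have hterm : ∀ n ∈ Finset.Ico M (N + 1), ((n : ℝ) ^ 2)⁻¹ ≤ 2 * (1 / (n : ℝ) - 1 / ((n : ℝ) + 1)) := by
    intro n hn
    have hn1 : (1 : ℝ) ≤ n := by exact_mod_cast le_trans hM (Finset.mem_Ico.mp hn).1
    have hn0 : (n : ℝ) ≠ 0 := by positivity
    have hn0' : (n : ℝ) + 1 ≠ 0 := by positivity
    have h := div_nonneg (sub_nonneg.mpr hn1) (by positivity : (0 : ℝ) ≤ (n : ℝ) ^ 2 * ((n : ℝ) + 1))
    have e : ((n : ℝ) - 1) / ((n : ℝ) ^ 2 * ((n : ℝ) + 1)) = 2 * (1 / (n : ℝ) - 1 / ((n : ℝ) + 1)) - ((n : ℝ) ^ 2)⁻¹ := by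
      field_simp
      ring
    rw [e] at h
    linarith
  calc ∑ n ∈ t, ((n : ℝ) ^ 2)⁻¹ ≤ ∑ n ∈ Finset.Ico M (N + 1), ((n : ℝ) ^ 2)⁻¹ :=
        Finset.sum_le_sum_of_subset_of_nonneg hsub fun n _ _ => by positivity
    _ ≤ ∑ n ∈ Finset.Ico M (N + 1), 2 * (1 / (n : ℝ) - 1 / ((n : ℝ) + 1)) := Finset.sum_le_sum hterm
    _ = 2 * (1 / (M : ℝ) - 1 / ((N + 1 : ℕ) : ℝ)) := by rw [← Finset.mul_sum, sum_Ico_inv_sub_inv M (N + 1) hMN]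
    _ ≤ 2 / M := by
        have h0 : (0 : ℝ) ≤ 1 / ((N + 1 : ℕ) : ℝ) := by positivity
        have e : (2 : ℝ) / M = 2 * (1 / (M : ℝ)) := by ring
        rw [e]
        nlinarith

/-- the shifted weight in terms of a natural number: `b(k − k₀) = ((|k − k₀| + 1 : ℕ)²)⁻¹`. -/
theorem bWeight_sub_eq (k k₀ : ℤ) : bWeight (k - k₀) = ((((k - k₀).natAbs + 1 : ℕ) : ℝ) ^ 2)⁻¹ := by
  simp only [bWeight, Nat.cast_add, Nat.cast_one, Nat.cast_natAbs, Int.cast_abs, Int.cast_sub]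
  ring

/-- ★ the shifted weight sum over integers at distance `≥ M` from `k₀`: `∑_{k ∈ s} b(k − k₀) ≤ 4/(M+1)`. -/
theorem sum_bWeight_sub_le (s : Finset ℤ) (k₀ : ℤ) (M : ℕ) (hs : ∀ k ∈ s, (M : ℤ) ≤ |k - k₀|) :
    ∑ k ∈ s, bWeight (k - k₀) ≤ 4 / ((M : ℝ) + 1) := by
  classical
  have hφ : ∀ k ∈ s, M + 1 ≤ (k - k₀).natAbs + 1 := by
    intro k hk
    have h1 := hs k hk
    have h2 : (M : ℤ) ≤ ((k - k₀).natAbs : ℤ) := by rwa [Int.natCast_natAbs]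
    omega
  have hA : ∀ s' : Finset ℤ, s' ⊆ s → Set.InjOn (fun k => (k - k₀).natAbs + 1) s' →
      ∑ k ∈ s', bWeight (k - k₀) ≤ 2 / ((M : ℝ) + 1) := by
    intro s' hs' hinj
    rw [Finset.sum_congr rfl fun k _ => bWeight_sub_eq k k₀,
      ← Finset.sum_image (f := fun n : ℕ => ((n : ℝ) ^ 2)⁻¹) hinj]
    have h := sum_inv_sq_le (s'.image fun k => (k - k₀).natAbs + 1) (M := M + 1) (by omega) fun n hn => by
      obtain ⟨k, hk, rfl⟩ := Finset.mem_image.mp hn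
      exact hφ k (hs' hk)
    simpa using h
  rw [← Finset.sum_filter_add_sum_filter_not s fun k => k₀ ≤ k]
  have h1 := hA (s.filter fun k => k₀ ≤ k) (Finset.filter_subset _ _) (by
    intro k hk k' hk' h
    have hk0 := (Finset.mem_filter.mp hk).2
    have hk0' := (Finset.mem_filter.mp hk').2
    have h' : (k - k₀).natAbs = (k' - k₀).natAbs := by simpa using h
    omega)
  have h2 := hA (s.filter fun k => ¬k₀ ≤ k) (Finset.filter_subset _ _) (by
    intro k hk k' hk' h
    have hk0 := (Finset.mem_filter.mp hk).2
    have hk0' := (Finset.mem_filter.mp hk').2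
    have h' : (k - k₀).natAbs = (k' - k₀).natAbs := by simpa using h
    omega)
  have e : (4 : ℝ) / ((M : ℝ) + 1) = 2 / ((M : ℝ) + 1) + 2 / ((M : ℝ) + 1) := by ring
  rw [e]
  exact add_le_add h1 h2

end OneDim

/-! ## 2. Product sums on `ℤ³` -/

section Product

/-- the product weight sum over a finite set is at most the product of the three coordinate sums. -/
theorem sum_vWeight_le_prod (k₀ : ℤ × ℤ × ℤ) (s : Finset (ℤ × ℤ × ℤ)) :
    ∑ k ∈ s, vWeight k₀ k ≤ (∑ i ∈ s.image (·.1), bWeight (i - k₀.1)) *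
      ((∑ j ∈ s.image (·.2.1), bWeight (j - k₀.2.1)) * (∑ l ∈ s.image (·.2.2), bWeight (l - k₀.2.2))) := by
  classical
  set t := (s.image (·.1)) ×ˢ ((s.image (·.2.1)) ×ˢ (s.image (·.2.2))) with ht
  have hsub : s ⊆ t := by
    intro k hk
    simp only [ht, Finset.mem_product, Finset.mem_image]
    exact ⟨⟨k, hk, rfl⟩, ⟨k, hk, rfl⟩, ⟨k, hk, rfl⟩⟩
  calc ∑ k ∈ s, vWeight k₀ k ≤ ∑ k ∈ t, vWeight k₀ k :=
        Finset.sum_le_sum_of_subset_of_nonneg hsub fun k _ _ => vWeight_nonneg k₀ k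
    _ = ∑ i ∈ s.image (·.1), ∑ j ∈ s.image (·.2.1), ∑ l ∈ s.image (·.2.2),
          bWeight (i - k₀.1) * (bWeight (j - k₀.2.1) * bWeight (l - k₀.2.2)) := by
        rw [ht, Finset.sum_product]
        refine Finset.sum_congr rfl fun i _ => ?_
        rw [Finset.sum_product]
        rfl
    _ = _ := by simp only [← Finset.mul_sum, ← Finset.sum_mul]

/-- ★ `∑_{k ∈ s} v_{k₀}(k) ≤ 192/(M+1)` when every grid point of `s` has SOME coordinate at distance `≥ M` from `k₀`
(`M = 0`: the hypothesis is void and this is the unconditional bound `192`). -/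
theorem sum_vWeight_le (k₀ : ℤ × ℤ × ℤ) (s : Finset (ℤ × ℤ × ℤ)) (M : ℕ)
    (hs : ∀ k ∈ s, (M : ℤ) ≤ |k.1 - k₀.1| ∨ (M : ℤ) ≤ |k.2.1 - k₀.2.1| ∨ (M : ℤ) ≤ |k.2.2 - k₀.2.2|) :
    ∑ k ∈ s, vWeight k₀ k ≤ 192 / ((M : ℝ) + 1) := by
  classical
  have h4 : ∀ (u : Finset ℤ) (c : ℤ), ∑ i ∈ u, bWeight (i - c) ≤ 4 := fun u c => by
    have h := sum_bWeight_sub_le u c 0 fun k _ => by simp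
    norm_num at h
    exact h
  have hn : ∀ (u : Finset ℤ) (c : ℤ), 0 ≤ ∑ i ∈ u, bWeight (i - c) := fun u c => Finset.sum_nonneg fun _ _ => bWeight_nonneg _
  have hM1 : (0 : ℝ) < (M : ℝ) + 1 := by positivity
  have hle4 : 4 / ((M : ℝ) + 1) ≤ 4 := by
    rw [div_le_iff₀ hM1]
    have : (0 : ℝ) ≤ M := by positivity
    nlinarith
  set A₁ := s.filter fun k => (M : ℤ) ≤ |k.1 - k₀.1| with hA₁
  set B := s.filter fun k => ¬(M : ℤ) ≤ |k.1 - k₀.1| with hB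
  set A₂ := B.filter fun k => (M : ℤ) ≤ |k.2.1 - k₀.2.1| with hA₂
  set A₃ := B.filter fun k => ¬(M : ℤ) ≤ |k.2.1 - k₀.2.1| with hA₃
  have hsplit : ∑ k ∈ s, vWeight k₀ k = ∑ k ∈ A₁, vWeight k₀ k + (∑ k ∈ A₂, vWeight k₀ k + ∑ k ∈ A₃, vWeight k₀ k) := by
    rw [hA₁, hA₂, hA₃, hB, Finset.sum_filter_add_sum_filter_not, Finset.sum_filter_add_sum_filter_not]
  have hA₃far : ∀ k ∈ A₃, (M : ℤ) ≤ |k.2.2 - k₀.2.2| := by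
    intro k hk
    have hk' := Finset.mem_filter.mp hk
    have hkB := Finset.mem_filter.mp hk'.1
    rcases hs k hkB.1 with h | h | h
    · exact absurd h hkB.2
    · exact absurd h hk'.2
    · exact h
  have b₁ : ∑ k ∈ A₁, vWeight k₀ k ≤ 4 / ((M : ℝ) + 1) * (4 * 4) := by
    refine (sum_vWeight_le_prod k₀ A₁).trans ?_
    have i1 : ∑ i ∈ A₁.image (·.1), bWeight (i - k₀.1) ≤ 4 / ((M : ℝ) + 1) :=
      sum_bWeight_sub_le _ _ M fun i hi => by
        obtain ⟨k, hk, rfl⟩ := Finset.mem_image.mp hi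
        exact (Finset.mem_filter.mp hk).2
    exact mul_le_mul i1 (mul_le_mul (h4 _ _) (h4 _ _) (hn _ _) (by norm_num)) (mul_nonneg (hn _ _) (hn _ _))
      (by positivity)
  have b₂ : ∑ k ∈ A₂, vWeight k₀ k ≤ 4 * (4 / ((M : ℝ) + 1) * 4) := by
    refine (sum_vWeight_le_prod k₀ A₂).trans ?_
    have i2 : ∑ j ∈ A₂.image (·.2.1), bWeight (j - k₀.2.1) ≤ 4 / ((M : ℝ) + 1) :=
      sum_bWeight_sub_le _ _ M fun j hj => by
        obtain ⟨k, hk, rfl⟩ := Finset.mem_image.mp hj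
        exact (Finset.mem_filter.mp hk).2
    exact mul_le_mul (h4 _ _) (mul_le_mul i2 (h4 _ _) (hn _ _) (by positivity)) (mul_nonneg (hn _ _) (hn _ _))
      (by norm_num)
  have b₃ : ∑ k ∈ A₃, vWeight k₀ k ≤ 4 * (4 * (4 / ((M : ℝ) + 1))) := by
    refine (sum_vWeight_le_prod k₀ A₃).trans ?_
    have i3 : ∑ l ∈ A₃.image (·.2.2), bWeight (l - k₀.2.2) ≤ 4 / ((M : ℝ) + 1) :=
      sum_bWeight_sub_le _ _ M fun l hl => by
        obtain ⟨k, hk, rfl⟩ := Finset.mem_image.mp hl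
        exact hA₃far k hk
    exact mul_le_mul (h4 _ _) (mul_le_mul (h4 _ _) i3 (hn _ _) (by norm_num)) (mul_nonneg (hn _ _) (hn _ _))
      (by norm_num)
  rw [hsplit]
  calc ∑ k ∈ A₁, vWeight k₀ k + (∑ k ∈ A₂, vWeight k₀ k + ∑ k ∈ A₃, vWeight k₀ k)
        ≤ 4 / ((M : ℝ) + 1) * (4 * 4) + (4 * (4 / ((M : ℝ) + 1) * 4) + 4 * (4 * (4 / ((M : ℝ) + 1)))) :=
        add_le_add b₁ (add_le_add b₂ b₃)
    _ = 192 / ((M : ℝ) + 1) := by ring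

/-- ★ the planar (two-dimensional) product sum: `∑_{k ∈ s} b(k₁ − c₁) b(k₂ − c₂) ≤ 32/(M+1)` when every point of `s` has some coordinate
at distance `≥ M` from `c` (`M = 0`: the unconditional bound `32`). -/
theorem sum_bWeight₂_le (c : ℤ × ℤ) (s : Finset (ℤ × ℤ)) (M : ℕ)
    (hs : ∀ k ∈ s, (M : ℤ) ≤ |k.1 - c.1| ∨ (M : ℤ) ≤ |k.2 - c.2|) :
    ∑ k ∈ s, bWeight (k.1 - c.1) * bWeight (k.2 - c.2) ≤ 32 / ((M : ℝ) + 1) := by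
  classical
  have h4 : ∀ (u : Finset ℤ) (c : ℤ), ∑ i ∈ u, bWeight (i - c) ≤ 4 := fun u c => by
    have h := sum_bWeight_sub_le u c 0 fun k _ => by simp
    norm_num at h
    exact h
  have hn : ∀ (u : Finset ℤ) (c : ℤ), 0 ≤ ∑ i ∈ u, bWeight (i - c) := fun u c => Finset.sum_nonneg fun _ _ => bWeight_nonneg _
  have hprod : ∀ u : Finset (ℤ × ℤ), ∑ k ∈ u, bWeight (k.1 - c.1) * bWeight (k.2 - c.2) ≤
      (∑ i ∈ u.image (·.1), bWeight (i - c.1)) * (∑ j ∈ u.image (·.2), bWeight (j - c.2)) := by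
    intro u
    set t := (u.image (·.1)) ×ˢ (u.image (·.2)) with ht
    have hsub : u ⊆ t := by
      intro k hk
      simp only [ht, Finset.mem_product, Finset.mem_image]
      exact ⟨⟨k, hk, rfl⟩, ⟨k, hk, rfl⟩⟩
    calc ∑ k ∈ u, bWeight (k.1 - c.1) * bWeight (k.2 - c.2) ≤ ∑ k ∈ t, bWeight (k.1 - c.1) * bWeight (k.2 - c.2) :=
          Finset.sum_le_sum_of_subset_of_nonneg hsub fun k _ _ => mul_nonneg (bWeight_nonneg _) (bWeight_nonneg _)
      _ = ∑ i ∈ u.image (·.1), ∑ j ∈ u.image (·.2), bWeight (i - c.1) * bWeight (j - c.2) := by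
          rw [ht, Finset.sum_product]
      _ = _ := by simp only [← Finset.mul_sum, ← Finset.sum_mul]
  set A₁ := s.filter fun k => (M : ℤ) ≤ |k.1 - c.1| with hA₁
  set A₂ := s.filter fun k => ¬(M : ℤ) ≤ |k.1 - c.1| with hA₂
  have hA₂far : ∀ k ∈ A₂, (M : ℤ) ≤ |k.2 - c.2| := by
    intro k hk
    have hk' := Finset.mem_filter.mp hk
    rcases hs k hk'.1 with h | h
    · exact absurd h hk'.2
    · exact h
  have b₁ : ∑ k ∈ A₁, bWeight (k.1 - c.1) * bWeight (k.2 - c.2) ≤ 4 / ((M : ℝ) + 1) * 4 := by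
    refine (hprod A₁).trans ?_
    have i1 : ∑ i ∈ A₁.image (·.1), bWeight (i - c.1) ≤ 4 / ((M : ℝ) + 1) :=
      sum_bWeight_sub_le _ _ M fun i hi => by
        obtain ⟨k, hk, rfl⟩ := Finset.mem_image.mp hi
        exact (Finset.mem_filter.mp hk).2
    exact mul_le_mul i1 (h4 _ _) (hn _ _) (by positivity)
  have b₂ : ∑ k ∈ A₂, bWeight (k.1 - c.1) * bWeight (k.2 - c.2) ≤ 4 * (4 / ((M : ℝ) + 1)) := by
    refine (hprod A₂).trans ?_
    have i2 : ∑ j ∈ A₂.image (·.2), bWeight (j - c.2) ≤ 4 / ((M : ℝ) + 1) :=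
      sum_bWeight_sub_le _ _ M fun j hj => by
        obtain ⟨k, hk, rfl⟩ := Finset.mem_image.mp hj
        exact hA₂far k hk
    exact mul_le_mul (h4 _ _) i2 (hn _ _) (by norm_num)
  rw [← Finset.sum_filter_add_sum_filter_not s fun k => (M : ℤ) ≤ |k.1 - c.1|]
  calc ∑ k ∈ A₁, bWeight (k.1 - c.1) * bWeight (k.2 - c.2) + ∑ k ∈ A₂, bWeight (k.1 - c.1) * bWeight (k.2 - c.2)
        ≤ 4 / ((M : ℝ) + 1) * 4 + 4 * (4 / ((M : ℝ) + 1)) := add_le_add b₁ b₂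
    _ = 32 / ((M : ℝ) + 1) := by ring

end Product

/-! ## 3. Span counting over the straddling pairs of a gap -/

section Span

/-- at most `n` straddling pairs `k < m ≤ l` of gap `m` have span `l − k = n` (cf. the series form `…OverbindingBudgetEnergyStraddleCount.sum_straddle_le` of lens-4). -/
theorem card_span_fibre_le (m : ℤ) (P : Finset (ℤ × ℤ)) (hP : ∀ p ∈ P, p.1 < m ∧ m ≤ p.2) (n : ℕ) :
    (P.filter fun p => (p.2 - p.1).toNat = n).card ≤ n := by
  classical
  calc (P.filter fun p => (p.2 - p.1).toNat = n).card ≤ (Finset.Ico (m - n) m).card :=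
        Finset.card_le_card_of_injOn (fun p => p.1) (fun p hp => by
          have hp' := Finset.mem_filter.mp (Finset.mem_coe.mp hp)
          have h1 := hP p hp'.1
          have h2 := hp'.2
          simp only [Finset.coe_Ico, Set.mem_Ico]
          omega) (by
          intro p hp p' hp' h
          have h1 := (Finset.mem_filter.mp hp).2
          have h2 := (Finset.mem_filter.mp hp').2
          have h3 := hP p (Finset.mem_filter.mp hp).1
          have h4 := hP p' (Finset.mem_filter.mp hp').1
          have h5 : p.1 = p'.1 := h
          exact Prod.ext h5 (by omega))
    _ = n := by rw [Int.card_Ico]; simp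

/-- ★ span counting: `∑_{pairs ∈ P} (l − k)⁻³ ≤ 2/S` for a finite set `P` of straddling pairs of span `≥ S ≥ 1`. -/
theorem sum_span_inv_cube_le (m : ℤ) (P : Finset (ℤ × ℤ)) (hP : ∀ p ∈ P, p.1 < m ∧ m ≤ p.2) {S : ℕ} (hS : 1 ≤ S)
    (hPS : ∀ p ∈ P, (S : ℤ) ≤ p.2 - p.1) : ∑ p ∈ P, ((((p.2 - p.1 : ℤ) : ℝ)) ^ 3)⁻¹ ≤ 2 / S := by
  classical
  set span : ℤ × ℤ → ℕ := fun p => (p.2 - p.1).toNat with hspan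
  have hcast : ∀ p ∈ P, ((p.2 - p.1 : ℤ) : ℝ) = (span p : ℝ) := fun p hp => by
    have h0 : 0 ≤ p.2 - p.1 := by have := hP p hp; omega
    have h1 : ((span p : ℕ) : ℤ) = p.2 - p.1 := Int.toNat_of_nonneg h0
    rw [← h1, Int.cast_natCast]
  have hSp : ∀ p ∈ P, S ≤ span p := fun p hp => by
    have h0 : 0 ≤ p.2 - p.1 := by have := hP p hp; omega
    have h1 : ((span p : ℕ) : ℤ) = p.2 - p.1 := Int.toNat_of_nonneg h0
    have h2 := hPS p hp
    omega
  rw [Finset.sum_congr rfl fun p hp => by rw [hcast p hp],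
    ← Finset.sum_fiberwise_of_maps_to (g := span) (fun p hp => Finset.mem_image_of_mem span hp)]
  have hinner : ∀ n ∈ P.image span,
      ∑ p ∈ P.filter (fun p => span p = n), (((span p : ℕ) : ℝ) ^ 3)⁻¹ ≤ (n : ℝ) * (((n : ℕ) : ℝ) ^ 3)⁻¹ := by
    intro n hn
    rw [Finset.sum_congr rfl fun p hp => by rw [(Finset.mem_filter.mp hp).2], Finset.sum_const, nsmul_eq_mul]
    have hcard : ((P.filter fun p => span p = n).card : ℝ) ≤ n := by exact_mod_cast card_span_fibre_le m P hP n
    exact mul_le_mul_of_nonneg_right hcard (by positivity)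
  calc ∑ n ∈ P.image span, ∑ p ∈ P.filter (fun p => span p = n), (((span p : ℕ) : ℝ) ^ 3)⁻¹
        ≤ ∑ n ∈ P.image span, (n : ℝ) * (((n : ℕ) : ℝ) ^ 3)⁻¹ := Finset.sum_le_sum hinner
    _ = ∑ n ∈ P.image span, ((n : ℝ) ^ 2)⁻¹ := by
        refine Finset.sum_congr rfl fun n hn => ?_
        obtain ⟨p, hp, rfl⟩ := Finset.mem_image.mp hn
        have hn1 : (1 : ℝ) ≤ (span p : ℕ) := by exact_mod_cast le_trans hS (hSp p hp)
        have hn0 : ((span p : ℕ) : ℝ) ≠ 0 := by positivity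
        field_simp
    _ ≤ 2 / S := sum_inv_sq_le _ hS fun n hn => by
        obtain ⟨p, hp, rfl⟩ := Finset.mem_image.mp hn
        exact hSp p hp

end Span

end Summit.AtomisticToContinuum.Crystallization.Theorems.ChartedPlanarOrderPlanesDomination
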